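import Literature.Analysis.FunctionSpaces.SmoothParametricIntegral
import Mathlib.Analysis.SpecialFunctions.Trigonometric.Deriv
import Mathlib.Analysis.Calculus.Deriv.Prod
import Mathlib.MeasureTheory.Integral.IntervalIntegral.IntegrationByParts
import HarnessLib

/-!
# The axis mean `P(t, θ) = (2π)⁻¹ ∫₀^{2π} β(θ + t cos ω) dω` solves the Euler–Poisson–Darboux equation

Support file (everything proved, no named facts) for the explicit vacuum spacetime of
`Literature.Geometry.Lorentzian.christodoulou_trapped_surface_formation_holds`.

For a smooth profile `β : ℝ → ℝ`, the **circular mean**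
`P(t, θ) = (2π)⁻¹ ∫₀^{2π} β(θ + t cos ω) dω` (the value on the axis of the superposition of the
plane waves `β(T + x cos ω + y sin ω)` of the `2+1` wave equation; equivalently Poisson's /
Darboux's mean of the one-dimensional datum `β` over the segment `[θ − t, θ + t]` with the
Chebyshev weight) is smooth on `ℝ²` and solves the **Euler–Poisson–Darboux equation**
`P_tt + P_t/t = P_θθ` for `t ≠ 0` — the polarized Gowdy equation for `P`
(`Gowdy.GowdyData.epd`). Proof: differentiation under the integral sign
(`Literature.Analysis.FunctionSpaces.fderiv_parametric_intervalIntegral_apply`) gives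
`P_t = ⟨cos ω β'⟩`, `P_tt = ⟨cos² ω β''⟩`, `P_θθ = ⟨β''⟩`, and one integration by parts in `ω`
(`d/dω β'(θ + t cos ω) = −t sin ω β''`) gives `t ⟨sin² ω β''⟩ = ⟨cos ω β'⟩`
(`Gowdy.epd_axisMean`). If `β` is constant on `[−R, R]` then `P` is that constant on the diamond
`|t| + |θ| ≤ R` (`Gowdy.axisMean_eq_of_const`). Darboux 1915, *Leçons* II, Livre IV, Ch. III;
Courant–Hilbert II, Ch. VI §13 (mean values and the Darboux equation); for the Gowdy context
Isenberg–Moncrief 1990, (4).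

## References

* R. Courant, D. Hilbert, *Methods of Mathematical Physics II*, Interscience 1962, Ch. VI, §13.
* J. Isenberg, V. Moncrief, Ann. Phys. 199 (1990) 84–122, eq. (4). [IsenbergMoncrief1990]
-/

noncomputable section

open Set Filter MeasureTheory intervalIntegral Real
open scoped Topology ContDiff

namespace Literature.Geometry.Lorentzian

namespace Gowdy

open Literature.Analysis.FunctionSpaces

/-- The argument `u(o; t, θ) = θ + t cos o`. [folklore] -/
def arg (o : ℝ) (q : ℝ × ℝ) : ℝ := q.2 + q.1 * cos o

/-- **Weighted circular means** `⟨c β⟩(t, θ) = (2π)⁻¹ ∫₀^{2π} c(o) β(θ + t cos o) do`.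
[cite: IsenbergMoncrief1990, (4)] -/
def wMean (c β : ℝ → ℝ) (q : ℝ × ℝ) : ℝ :=
  (2 * π)⁻¹ * ∫ o in (0 : ℝ)..2 * π, c o * β (arg o q)

/-- **The axis mean** `P(t, θ) = (2π)⁻¹ ∫₀^{2π} β(θ + t cos o) do`. [cite: IsenbergMoncrief1990, (4)] -/
def axisMean (β : ℝ → ℝ) (q : ℝ × ℝ) : ℝ := wMean (fun _ ↦ 1) β q

/-- Unfolding lemma for `axisMean`. [folklore] -/
theorem axisMean_eq (β : ℝ → ℝ) (q : ℝ × ℝ) :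
    axisMean β q = (2 * π)⁻¹ * ∫ o in (0 : ℝ)..2 * π, β (q.2 + q.1 * cos o) := by
  simp [axisMean, wMean, arg]

/-- The argument map is smooth in `(o, t, θ)`. [folklore] -/
theorem contDiff_arg : ContDiff ℝ ∞ (fun p : ℝ × (ℝ × ℝ) ↦ arg p.1 p.2) := by
  unfold arg
  fun_prop

/-- The argument map is smooth (uncurried on `ℝ × (ℝ × ℝ)`), any order. [folklore] -/
theorem contDiff_arg' {m : WithTop ℕ∞} : ContDiff ℝ m (fun p : ℝ × (ℝ × ℝ) ↦ arg p.1 p.2) := by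
  unfold arg
  fun_prop

variable {c β : ℝ → ℝ}

/-- The weighted integrand is smooth in `(o, t, θ)`. [folklore] -/
theorem contDiff_integrand (hc : ContDiff ℝ ∞ c) (hβ : ContDiff ℝ ∞ β) :
    ContDiff ℝ ∞ (fun p : ℝ × (ℝ × ℝ) ↦ c p.1 * β (arg p.1 p.2)) :=
  (hc.comp contDiff_fst).mul (hβ.comp contDiff_arg)

/-- **Weighted circular means of smooth profiles are smooth** (differentiation under the
integral sign, `contDiff_parametric_intervalIntegral`). [folklore] -/
theorem contDiff_wMean (hc : ContDiff ℝ ∞ c) (hβ : ContDiff ℝ ∞ β) : ContDiff ℝ ∞ (wMean c β) :=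
  contDiff_const.mul (contDiff_parametric_intervalIntegral (contDiff_integrand hc hβ) _ _)

/-- The axis mean of a smooth profile is smooth. [folklore] -/
theorem contDiff_axisMean (hβ : ContDiff ℝ ∞ β) : ContDiff ℝ ∞ (axisMean β) :=
  contDiff_wMean contDiff_const hβ

/-- The derivative of the integrand in the parameter directions:
`D[(t,θ) ↦ c(o) β(θ + t cos o)](v) = c(o) β'(θ + t cos o) (v₂ + v₁ cos o)`. [folklore] -/
theorem fderiv_integrand (hc : ContDiff ℝ ∞ c) (hβ : ContDiff ℝ ∞ β) (o : ℝ) (q v : ℝ × ℝ) :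
    fderiv ℝ (fun p : ℝ × (ℝ × ℝ) ↦ c p.1 * β (arg p.1 p.2)) (o, q) ((0 : ℝ), v) =
      c o * (deriv β (arg o q) * (v.2 + v.1 * cos o)) := by
  -- restrict to the slice `o = const`: a function of `q` alone
  have hslice : HasFDerivAt (fun p : ℝ × (ℝ × ℝ) ↦ c p.1 * β (arg p.1 p.2))
      (fderiv ℝ (fun p : ℝ × (ℝ × ℝ) ↦ c p.1 * β (arg p.1 p.2)) (o, q)) (o, q) :=
    (((contDiff_integrand hc hβ).differentiable (by simp)) (o, q)).hasFDerivAt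
  have hline : HasDerivAt (fun s : ℝ ↦ c o * β (arg o (q + s • v)))
      (fderiv ℝ (fun p : ℝ × (ℝ × ℝ) ↦ c p.1 * β (arg p.1 p.2)) (o, q) ((0 : ℝ), v)) 0 := by
    have hl : HasDerivAt (fun s : ℝ ↦ ((o, q + s • v) : ℝ × (ℝ × ℝ))) ((0 : ℝ), v) 0 := by
      have h2 : HasDerivAt (fun s : ℝ ↦ q + s • v) v 0 := by
        simpa using ((hasDerivAt_id (0 : ℝ)).smul_const v).const_add q
      exact (hasDerivAt_const (0 : ℝ) o).prodMk h2
    have h := HasFDerivAt.comp_hasDerivAt_of_eq (x := (0 : ℝ)) hslice hl (by simp)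
    simpa [Function.comp_def] using h
  -- compute the same line derivative directly
  have hβd : ∀ x, HasDerivAt β (deriv β x) x := fun x ↦
    ((hβ.differentiable (by simp)) x).hasDerivAt
  have hline' : HasDerivAt (fun s : ℝ ↦ c o * β (arg o (q + s • v)))
      (c o * (deriv β (arg o q) * (v.2 + v.1 * cos o))) 0 := by
    have harg : HasDerivAt (fun s : ℝ ↦ arg o (q + s • v)) (v.2 + v.1 * cos o) 0 := by
      have h1 : (fun s : ℝ ↦ arg o (q + s • v)) = fun s ↦ (q.2 + q.1 * cos o) + s * (v.2 + v.1 * cos o) := by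
        funext s; simp [arg]; ring
      rw [h1]
      simpa using ((hasDerivAt_id (0 : ℝ)).mul_const (v.2 + v.1 * cos o)).const_add (q.2 + q.1 * cos o)
    have h2 := (hβd _).comp (0 : ℝ) harg
    have h3 : arg o (q + (0 : ℝ) • v) = arg o q := by simp
    rw [h3] at h2
    exact (h2.const_mul (c o))
  exact hline.unique hline'

/-- **`∂_v ⟨c β⟩ = ⟨c (v₂ + v₁ cos o) β'⟩`**: the directional derivatives of a weighted mean.
[folklore] -/
theorem fderiv_wMean (hc : ContDiff ℝ ∞ c) (hβ : ContDiff ℝ ∞ β) (q v : ℝ × ℝ) :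
    fderiv ℝ (wMean c β) q v = wMean (fun o ↦ c o * (v.2 + v.1 * cos o)) (deriv β) q := by
  unfold wMean
  rw [fderiv_const_mul ((differentiable_parametric_intervalIntegral (contDiff_integrand hc hβ)
    (by simp) _ _) q), FunLike.coe_smul, Pi.smul_apply, smul_eq_mul,
    fderiv_parametric_intervalIntegral_apply (contDiff_integrand hc hβ) (by simp)]
  congr 1
  refine intervalIntegral.integral_congr fun o _ ↦ ?_
  simp only [fderiv_integrand hc hβ]
  ring

/-- `P_t = ⟨cos o β'⟩`. [folklore] -/
theorem fderiv_wMean_t (hc : ContDiff ℝ ∞ c) (hβ : ContDiff ℝ ∞ β) (q : ℝ × ℝ) :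
    fderiv ℝ (wMean c β) q ((1 : ℝ), (0 : ℝ)) = wMean (fun o ↦ c o * cos o) (deriv β) q := by
  rw [fderiv_wMean hc hβ]
  simp

/-- `P_θ = ⟨β'⟩`. [folklore] -/
theorem fderiv_wMean_θ (hc : ContDiff ℝ ∞ c) (hβ : ContDiff ℝ ∞ β) (q : ℝ × ℝ) :
    fderiv ℝ (wMean c β) q ((0 : ℝ), (1 : ℝ)) = wMean c (deriv β) q := by
  rw [fderiv_wMean hc hβ]
  simp

/-- The derivative of a smooth function is smooth. [folklore] -/
theorem contDiff_deriv_of_contDiff (hβ : ContDiff ℝ ∞ β) : ContDiff ℝ ∞ (deriv β) :=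
  (contDiff_infty_iff_deriv.1 hβ).2

/-- **Integration by parts in the angle**: `t ⟨sin² o β''⟩ = ⟨cos o β'⟩`, from
`d/do β'(θ + t cos o) = −t sin o β''(θ + t cos o)` and the periodicity of the boundary term.
[folklore] -/
theorem mean_sin_sq (hβ : ContDiff ℝ ∞ β) (q : ℝ × ℝ) :
    q.1 * wMean (fun o ↦ sin o ^ 2) (deriv (deriv β)) q = wMean cos (deriv β) q := by
  unfold wMean
  have hβ1 : ContDiff ℝ ∞ (deriv β) := contDiff_deriv_of_contDiff hβ
  have hβ2 : ContDiff ℝ ∞ (deriv (deriv β)) := contDiff_deriv_of_contDiff hβ1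
  have hd1 : ∀ x, HasDerivAt (deriv β) (deriv (deriv β) x) x := fun x ↦
    ((hβ1.differentiable (by simp)) x).hasDerivAt
  -- `v o = β'(θ + t cos o)`, `v' o = −t sin o β''(θ + t cos o)`
  have hv : ∀ o ∈ uIcc (0 : ℝ) (2 * π), HasDerivAt (fun o ↦ deriv β (arg o q))
      (-(q.1 * sin o) * deriv (deriv β) (arg o q)) o := by
    intro o _
    have harg : HasDerivAt (fun o ↦ arg o q) (-(q.1 * sin o)) o := by
      unfold arg
      simpa using ((hasDerivAt_cos o).const_mul q.1).const_add q.2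
    have h := (hd1 (arg o q)).comp o harg
    simpa [Function.comp_def, mul_comm] using h
  have hu : ∀ o ∈ uIcc (0 : ℝ) (2 * π), HasDerivAt sin (cos o) o := fun o _ ↦ hasDerivAt_sin o
  have hcont_v' : Continuous fun o ↦ -(q.1 * sin o) * deriv (deriv β) (arg o q) := by
    have : Continuous fun o ↦ arg o q := by unfold arg; fun_prop
    exact ((continuous_const.mul continuous_sin).neg).mul (hβ2.continuous.comp this)
  have hparts := intervalIntegral.integral_mul_deriv_eq_deriv_mul hu hv
    (continuous_cos.intervalIntegrable _ _) (hcont_v'.intervalIntegrable _ _)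
  -- boundary terms vanish: `sin 0 = sin 2π = 0`
  simp only [sin_zero, zero_mul, sin_two_pi, sub_zero] at hparts
  -- `∫ sin o · (−t sin o β'') = −∫ cos o β'`
  have hlhs : ∫ o in (0 : ℝ)..2 * π, sin o * (-(q.1 * sin o) * deriv (deriv β) (arg o q)) =
      -(q.1 * ∫ o in (0 : ℝ)..2 * π, sin o ^ 2 * deriv (deriv β) (arg o q)) := by
    rw [← intervalIntegral.integral_const_mul, ← intervalIntegral.integral_neg]
    refine intervalIntegral.integral_congr fun o _ ↦ ?_
    ring
  rw [hlhs] at hparts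
  have hfin : q.1 * ∫ o in (0 : ℝ)..2 * π, sin o ^ 2 * deriv (deriv β) (arg o q) =
      ∫ o in (0 : ℝ)..2 * π, cos o * deriv β (arg o q) := by linarith
  rw [← mul_assoc, mul_comm q.1, mul_assoc, hfin]

/-- **The axis mean solves the Euler–Poisson–Darboux (polarized Gowdy) equation**
`P_tt + P_t / t = P_θθ` for `t ≠ 0` (Darboux; Courant–Hilbert II, Ch. VI §13; Isenberg–Moncrief
1990, (4)). [cite: IsenbergMoncrief1990, (4)] -/
theorem epd_axisMean (hβ : ContDiff ℝ ∞ β) (q : ℝ × ℝ) (hq : q.1 ≠ 0) :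
    fderiv ℝ (fun p ↦ fderiv ℝ (axisMean β) p ((1 : ℝ), (0 : ℝ))) q ((1 : ℝ), (0 : ℝ)) +
        fderiv ℝ (axisMean β) q ((1 : ℝ), (0 : ℝ)) / q.1 =
      fderiv ℝ (fun p ↦ fderiv ℝ (axisMean β) p ((0 : ℝ), (1 : ℝ))) q ((0 : ℝ), (1 : ℝ)) := by
  have hβ1 : ContDiff ℝ ∞ (deriv β) := contDiff_deriv_of_contDiff hβ
  have hcos : ContDiff ℝ ∞ cos := contDiff_cos
  -- first derivatives as weighted means
  have h1 : (fun p ↦ fderiv ℝ (axisMean β) p ((1 : ℝ), (0 : ℝ))) = wMean cos (deriv β) := by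
    funext p
    rw [show (axisMean β) = wMean (fun _ ↦ 1) β from rfl, fderiv_wMean_t contDiff_const hβ]
    simp [wMean]
  have h2 : (fun p ↦ fderiv ℝ (axisMean β) p ((0 : ℝ), (1 : ℝ))) = wMean (fun _ ↦ 1) (deriv β) := by
    funext p
    rw [show (axisMean β) = wMean (fun _ ↦ 1) β from rfl, fderiv_wMean_θ contDiff_const hβ]
  rw [h1, h2, fderiv_wMean_t hcos hβ1, fderiv_wMean_θ contDiff_const hβ1,
    show axisMean β = wMean (fun _ ↦ 1) β from rfl, fderiv_wMean_t contDiff_const hβ]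
  simp only [one_mul]
  -- `⟨cos² β''⟩ + ⟨cos β'⟩/t = ⟨β''⟩` iff `t⟨sin² β''⟩ = ⟨cos β'⟩`
  have hkey := mean_sin_sq hβ q
  have hsplit : wMean (fun o ↦ cos o * cos o) (deriv (deriv β)) q =
      wMean (fun _ ↦ (1 : ℝ)) (deriv (deriv β)) q - wMean (fun o ↦ sin o ^ 2) (deriv (deriv β)) q := by
    unfold wMean
    rw [← mul_sub, ← intervalIntegral.integral_sub]
    · congr 1
      refine intervalIntegral.integral_congr fun o _ ↦ ?_
      have := sin_sq_add_cos_sq o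
      simp only [one_mul]
      linear_combination (deriv (deriv β) (arg o q)) * this
    · have : Continuous fun o ↦ arg o q := by unfold arg; fun_prop
      exact (continuous_const.mul ((contDiff_deriv_of_contDiff hβ1).continuous.comp this)).intervalIntegrable _ _
    · have : Continuous fun o ↦ arg o q := by unfold arg; fun_prop
      exact ((continuous_sin.pow 2).mul ((contDiff_deriv_of_contDiff hβ1).continuous.comp this)).intervalIntegrable _ _
  rw [hsplit]
  have hcos' : wMean (fun o ↦ cos o) (deriv β) q = wMean cos (deriv β) q := rfl
  have hs : wMean (fun o ↦ sin o ^ 2) (deriv (deriv β)) q = wMean cos (deriv β) q / q.1 := by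
    rw [← hkey]
    field_simp
  rw [hcos', hs]
  ring

/-- **The axis mean is constant on the diamond of a constant profile**: if `β = k` on
`[−R, R]` then `P(t, θ) = k` whenever `|t| + |θ| ≤ R` (all arguments `θ + t cos o` lie in
`[−R, R]`). [folklore] -/
theorem axisMean_eq_of_const {k R : ℝ} (hβ : ∀ τ, |τ| ≤ R → β τ = k) (q : ℝ × ℝ)
    (hq : |q.1| + |q.2| ≤ R) : axisMean β q = k := by
  rw [axisMean_eq]
  have harg : ∀ o, β (q.2 + q.1 * cos o) = k := by
    intro o
    apply hβ
    calc |q.2 + q.1 * cos o| ≤ |q.2| + |q.1 * cos o| := abs_add_le _ _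
      _ = |q.2| + |q.1| * |cos o| := by rw [abs_mul]
      _ ≤ |q.2| + |q.1| * 1 := by gcongr; exact abs_cos_le_one o
      _ ≤ R := by linarith
  simp_rw [harg]
  rw [intervalIntegral.integral_const, smul_eq_mul]
  have hπ : (2 * π) ≠ 0 := by positivity
  field_simp
  ring

end Gowdy

end Literature.Geometry.Lorentzian
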